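import Summits.ResolutionOfSingularities.ResolutionOfSingularities.Theorems.DecompositionDescentLU
import HarnessLib

/-!
# DecompositionDescentLU (2/7) — the engine of layer 1 (Hensel root ⇒ `K′ ⊆ Z`; regularity comes down from the
integral closure); the decomposition-descent cell and THE LAW

Part 2 of the g27 node `DecompositionDescentLU` of the ROOT/RESIDUAL decomposition cell `decomp-res`
(lens 1, window (W-dec) of critic rows 178/193/202); see the module docstring of
`Summits.ResolutionOfSingularities.ResolutionOfSingularities.Theorems.DecompositionDescentLU` (part 1/7)
for the thesis, the three layers of [CossartPiltant2008, Prop. 9.3], the two currencies of the decomposition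
cell (structure: `DecompositionFieldLUAbove`; witnesses: `DecWitnessLUAbove`), the laws, the residual R27, the
cut and the sources.  Problem side, sorry-free, hypothesis-free.

This part: `exists_finset_regular_below` — the tree's `DecompositionLayerRegularity` made hypothesis-free
(`K(η) ⊆ Z` from part 1's `closure_le_decompositionField`, `dim R₁ = dim R₁′` from part 1's
`ringKrullDim_centre_eq_of_isIntegral`); `isFractionRing_of_le`, the cell `DecompositionFieldLUAbove k O` and the law
`relLU_of_decompositionFieldLUAbove : DecompositionFieldLUAbove k O → RelLocalUniformization k K O` (kernel, hypothesis-free).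
-/

noncomputable section

open IsLocalRing IntermediateField Polynomial Literature.AlgebraicGeometry.Resolution
open scoped Pointwise

namespace Summit.ResolutionOfSingularities.ResolutionOfSingularities.Theorems.DecompositionDescentLU

universe u

section Engine

variable {E : Type u} [Field E] (OE : ValuationSubring E) {M : Subfield E}

/-! ### A3. The engine: regularity comes down from the integral closure in a field generated by a Hensel root -/

/-- **THE ENGINE ([CoP1] Prop. 9.3, decomposition layer, made hypothesis-free in the frame).**  Let `k → E` be a
field inside the big field `E` with image in the subfield `M`, `E | M` normal (e.g. `E = K̄`), `O_E` a valuation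
ring of `E`, and `η ∈ O_E` a HENSEL ROOT over `M ∩ O_E` with `M`-rational residue (`f(η) = 0`, `v(f′(η)) = 1`,
`v(η − x₀) < 1`, `x₀ ∈ M`).  Then there is a finite `c ⊆ M ∩ O_E` such that for every field `K′` with
`M ≤ K′ ≤ M(η)`, every NORMAL affine model `k[t₁] ⊆ M ∩ O_E` of `M` containing `c` and its integral closure
`k[t₁ ∪ t₁′]` in `K′`: if `k[t₁ ∪ t₁′]` is REGULAR at the centre of `O_E`, then so is `k[t₁]`.
Assembly: `M(η)` lies in the decomposition field of the Galois closure `N` of `M(η)` (`closure_le_decompositionField`,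
`η` separable by `isSeparable_of_henselRoot`); Cossart–Piltant's "R is regular since S′ is by (45)" in the frame
(tree `exists_finset_isRegularLocalRing_of_regular`: Galois approximation density + unramifiedness + analytic
irreducibility + dense regular descent); equality of dimensions by `ringKrullDim_centre_eq_of_isIntegral`. (Sources:
CossartPiltant2008, Prop. 9.3 (HAL pp. 26–28); KnafKuhlmann2009, Lemma 3.7.) -/
theorem exists_finset_regular_below (k : Type u) [Field k] [Algebra k E] (hkM : ∀ c : k, algebraMap k E c ∈ M)
    [Normal M E] {η : E} (hηO : η ∈ OE) {x₀ : E} (hx₀ : x₀ ∈ M) (hηx₀ : OE.valuation (η - x₀) < 1)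
    {f : E[X]} (hfM : ∀ i, f.coeff i ∈ M) (hfO : ∀ i, f.coeff i ∈ OE) (hfη : f.eval η = 0)
    (hder : OE.valuation ((derivative f).eval η) = 1) :
    ∃ c : Finset E, (c : Set E) ⊆ (M : Set E) ∧ (∀ x ∈ c, x ∈ OE) ∧
      ∀ (K' : Subfield E), M ≤ K' → K' ≤ Subfield.closure ((M : Set E) ∪ {η}) →
      ∀ (t₁ : Finset E), (t₁ : Set E) ⊆ M →
        M ≤ Subfield.closure (Set.range (algebraMap k E) ∪ (t₁ : Set E)) →
      ∀ (ht₁O : (Algebra.adjoin k (t₁ : Set E)).toSubring ≤ OE.toSubring),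
        (∀ x : E, x ∈ M → IsIntegral (Algebra.adjoin k (t₁ : Set E)) x → x ∈ Algebra.adjoin k (t₁ : Set E)) →
        (c : Set E) ⊆ Algebra.adjoin k (t₁ : Set E) →
      ∀ (t₁' : Finset E), (t₁' : Set E) ⊆ K' →
        (∀ x : E, x ∈ K' → (IsIntegral (Algebra.adjoin k (t₁ : Set E)) x ↔
          x ∈ Algebra.adjoin k ((t₁ : Set E) ∪ (t₁' : Set E)))) →
      ∀ (hO' : (Algebra.adjoin k ((t₁ : Set E) ∪ (t₁' : Set E))).toSubring ≤ OE.toSubring),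
        IsRegularLocalRing (locAtCentre (Algebra.adjoin k ((t₁ : Set E) ∪ (t₁' : Set E))).toSubring OE) →
        IsRegularLocalRing (Localization.AtPrime
          (Ideal.comap (Subring.inclusion ht₁O) (maximalIdeal OE))) := by
  classical
  -- `η` is integral and separable over `M`; `L = M(η)`, `N` its Galois closure in `E`
  have hint : IsIntegral M η := isIntegral_of_henselRoot OE hfM hfη hder
  have hsep : IsSeparable M η := isSeparable_of_henselRoot OE hfM hfη hder
  let L : IntermediateField M E := M⟮η⟯
  haveI : FiniteDimensional M L := IntermediateField.adjoin.finiteDimensional hint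
  haveI : Algebra.IsSeparable M L :=
    (IntermediateField.isSeparable_adjoin_simple_iff_isSeparable M E).mpr hsep
  let N : IntermediateField M E := normalClosure M L E
  haveI : FiniteDimensional M N := normalClosure.is_finiteDimensional M L E
  haveI : Algebra.IsSeparable M N := by
    have h : ∀ g : L →ₐ[M] E, Algebra.IsSeparable M g.fieldRange := fun g =>
      AlgEquiv.Algebra.isSeparable (AlgEquiv.ofInjectiveField g)
    show Algebra.IsSeparable M (normalClosure M L E)
    rw [normalClosure_def]
    infer_instance
  haveI : IsGalois M N := isGalois_iff.mpr ⟨inferInstance, inferInstance⟩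
  have hLN : L ≤ N := IntermediateField.le_normalClosure L
  have hηL : η ∈ L := IntermediateField.mem_adjoin_simple_self M η
  have hηN : η ∈ N := hLN hηL
  -- `M(η)` lies in the decomposition field of `N`
  have hZ := closure_le_decompositionField OE N hηN hηO hx₀ hηx₀ hfM hfO hfη hder
  have hclL : Subfield.closure ((M : Set E) ∪ {η}) ≤ L.toSubfield := by
    refine Subfield.closure_le.mpr ?_
    rintro x (hx | hx)
    · exact L.algebraMap_mem ⟨x, hx⟩
    · rw [Set.mem_singleton_iff] at hx
      rw [hx]; exact hηL
  -- Cossart–Piltant (45) in the frame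
  obtain ⟨c, hcM, hcO, hreg⟩ :=
    exists_finset_isRegularLocalRing_of_regular k (isExcellentRing_of_field k) E OE M hkM N
  refine ⟨c, hcM, hcO, ?_⟩
  intro K' hMK' hK'cl t₁ ht₁M hMcl ht₁O hnorm hct₁ t₁' ht₁'K' hext hO' hreg'
  have hK'N : K' ≤ N.toSubfield := (hK'cl.trans hclL).trans hLN
  have hK'Z : K' ≤ (IntermediateField.lift (fixedField (decompositionGroupIn OE N))).toSubfield :=
    hK'cl.trans hZ
  -- the integral closure `k[t₁ ∪ t₁′]` lies in `K′`, hence is integral over `k[t₁]`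
  have hT'K' : ∀ x ∈ Algebra.adjoin k ((t₁ : Set E) ∪ (t₁' : Set E)), x ∈ K' := by
    intro x hx
    refine (Algebra.adjoin_le (S := { K'.toSubring with algebraMap_mem' := fun c => hMK' (hkM c) }) ?_) hx
    rintro y (hy | hy)
    · exact hMK' (ht₁M hy)
    · exact ht₁'K' hy
  have hintT' : ∀ x ∈ Algebra.adjoin k ((t₁ : Set E) ∪ (t₁' : Set E)),
      IsIntegral (Algebra.adjoin k (t₁ : Set E)) x := fun x hx => (hext x (hT'K' x hx)).mpr hx
  exact hreg K' hMK' hK'N hK'Z t₁ ht₁M hMcl ht₁O hnorm hct₁ t₁' ht₁'K' hext hO' hreg'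
    (ringKrullDim_centre_eq_of_isIntegral OE k t₁ t₁' ht₁O hO' hintT')

end Engine

/-! ## PART B — the cell `DecompositionFieldLUAbove` and THE LAW (summit frame `k ⊆ K`, `O` a valuation ring of `K`) -/

section Law

variable {k K : Type} [Field k] [Field K] [Algebra k K]

/-- A subalgebra containing a subalgebra with fraction field `K` has fraction field `K`. [folklore] -/
theorem isFractionRing_of_le {R A : Subalgebra k K} (hRA : R ≤ A) [h : IsFractionRing R K] :
    IsFractionRing A K := by
  haveI : FaithfulSMul A K := (faithfulSMul_iff_algebraMap_injective A K).mpr Subtype.val_injective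
  refine IsFractionRing.of_field A K fun z => ?_
  obtain ⟨a, b, -, hab⟩ := IsFractionRing.div_surjective (A := R) z
  exact ⟨⟨a, hRA a.2⟩, ⟨b, hRA b.2⟩, hab.symm⟩

variable (k)

/-- **THE CELL `DecompositionFieldLUAbove k O` — uniformization by NORMALIZED BASE CHANGE inside the DECOMPOSITION
FIELD** (a typed SYNTACTIC sub-class of places `(K, O)` over `k`, new as a kind; everything read inside `K̄`).
There are: a valuation ring `O_E` of `K̄` above `O`; a HENSEL ROOT `η ∈ O_E` over `O` with `K`-rational residue
(`f ∈ O[X]`, `f(η) = 0`, `v(f′(η)) = 1`, `v(η − x) < 1` for some `x ∈ K`) — so that `K(η)` is a finite separable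
layer of the henselization `K^h = K̄^{G_Z(O_E)}·…` (tree `closure_le_decompositionField`); and a field
`K ≤ K′ ≤ K(η)`; such that EVERY finitely generated model `R ⊆ O` of `K | k` is dominated by a NORMAL affine model
`k[t₁] ⊆ O` of `K` (`t₁ ⊆ K`, integrally closed in `K`) whose INTEGRAL CLOSURE `k[t₁ ∪ t₁′]` in `K′`
(`t₁′ ⊆ K′`) is REGULAR at the centre of `O_E`.  Informally: after the finite "étale" base change `K → K′`
inside the decomposition field, the normalizations of the normal models of `K` are local uniformizations of
`(K′, O_E ∩ K′)`.  Where it sits: it is the EXACT INPUT of the decomposition-layer step of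
[CossartPiltant2008, Prop. 9.3] ("R is regular since S′ is by (45)"), i.e. the part of Kuhlmann's
henselization-descent problem ([Kuhlmann2000, §13], [CossartPiltant2008, Problem 9.2]) that survives WITHOUT
the upstairs monomialization [CossartPiltant2008, Prop. 8.1] (which needs embedded principalization upstairs,
open in dimension `≥ 4` in positive characteristic); the quasi-finite form of the same input (a regular model of
`K′` radical over finitely many `K`-functions at the closed point, [CossartPiltant2008, (52)]) reduces to it by
Zariski's Main Theorem (NODE-g27.md §4, NEXT-g28.md).  NOT a costume: `RelLocalUniformization k K O → Cell`
would require REALISING a regular model upstairs as the normalization of a normal model downstairs for a Hensel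
layer `K′ ≠ K` — étale ASCENT plus normality bookkeeping, a theorem but not a restatement — and for `K′ = K`,
`η ∈ K` the cell says exactly "every model is dominated by a normal model regular at the centre", which is
`RelLU` up to normalization (Zariski): the cell is the union over the Hensel layers `K′` of the transported
problems, and the law below is the DOWNWARD transfer along every layer at once.  Non-degenerate instances
(`K′ ≠ K`, upstairs chart not defined over `K`): NODE-g27.md §3 (`k(x,y)`, `η² = 1 + x`, `char k ≠ 2`). (Sources:
CossartPiltant2008, Prop. 9.3 and Problem 9.2 (HAL pp. 26–28); KnafKuhlmann2009, Lemma 3.7.) -/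
def DecompositionFieldLUAbove (O : ValuationSubring K) : Prop :=
  ∃ OE : ValuationSubring (AlgebraicClosure K), OE.comap (algebraMap K (AlgebraicClosure K)) = O ∧
  ∃ η : AlgebraicClosure K, η ∈ OE ∧
    (∃ x : K, OE.valuation (η - algebraMap K (AlgebraicClosure K) x) < 1) ∧
    (∃ f : Polynomial K, (∀ i, f.coeff i ∈ O) ∧ Polynomial.aeval η f = 0 ∧
      OE.valuation (Polynomial.aeval η (Polynomial.derivative f)) = 1) ∧
  ∃ K' : IntermediateField K (AlgebraicClosure K), K' ≤ K⟮η⟯ ∧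
  ∀ R : Subalgebra k K, R.FG → IsFractionRing R K → R.toSubring ≤ O.toSubring →
    ∃ t₁ : Finset (AlgebraicClosure K),
      (t₁ : Set (AlgebraicClosure K)) ⊆ Set.range (algebraMap K (AlgebraicClosure K)) ∧
      R.map (IsScalarTower.toAlgHom k K (AlgebraicClosure K)) ≤
        Algebra.adjoin k (t₁ : Set (AlgebraicClosure K)) ∧
      (Algebra.adjoin k (t₁ : Set (AlgebraicClosure K))).toSubring ≤ OE.toSubring ∧
      (∀ x : K, IsIntegral (Algebra.adjoin k (t₁ : Set (AlgebraicClosure K)))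
          (algebraMap K (AlgebraicClosure K) x) →
        algebraMap K (AlgebraicClosure K) x ∈ Algebra.adjoin k (t₁ : Set (AlgebraicClosure K))) ∧
    ∃ t₁' : Finset (AlgebraicClosure K), (t₁' : Set (AlgebraicClosure K)) ⊆ (K' : Set (AlgebraicClosure K)) ∧
      (∀ x ∈ K', IsIntegral (Algebra.adjoin k (t₁ : Set (AlgebraicClosure K))) x ↔
        x ∈ Algebra.adjoin k ((t₁ : Set (AlgebraicClosure K)) ∪ (t₁' : Set (AlgebraicClosure K)))) ∧
      ∃ _ : (Algebra.adjoin k ((t₁ : Set (AlgebraicClosure K)) ∪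
          (t₁' : Set (AlgebraicClosure K)))).toSubring ≤ OE.toSubring,
        IsRegularLocalRing (locAtCentre (Algebra.adjoin k ((t₁ : Set (AlgebraicClosure K)) ∪
          (t₁' : Set (AlgebraicClosure K)))).toSubring OE)

variable {k}

set_option maxHeartbeats 1600000 in
/-- **THE LAW OF DECOMPOSITION DESCENT (kernel, HYPOTHESIS-FREE): `DecompositionFieldLUAbove k O →
RelLocalUniformization k K O`.**  Regularity COMES DOWN through every finite layer of the decomposition field:
given a model `R ⊆ O`, enlarge it by the (finitely many, `K`-rational) Galois-approximation coefficients `c` of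
the engine, let the cell dominate `R[c]` by a normal model `k[t₁]` whose integral closure in `K′` is regular at the
centre; the engine (`exists_finset_regular_below`: `K′ ⊆ Z` by rigidity of the Hensel root, density
`R₁/𝔪₁ⁿ = R₁′/𝔪₁′ⁿ` by Galois approximation in the decomposition group [CossartPiltant2008, (44)],
`𝔪₁R₁′ = 𝔪₁′`, analytic irreducibility of the excellent normal `R₁`, equal dimensions, and (45)
`R₁ regular ⇔ R̂₁ = R̂₁′ regular`) makes `k[t₁]` regular at the centre of `O_E`; pull `k[t₁]` back to `K`
(`t₁ ⊆ K`) and transport the local ring along `K ↪ K̄` (`IsLocalization.ringEquivOfRingEquiv`).  No port, no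
`TheoremD`, no named fact. (Sources: CossartPiltant2008, Prop. 9.3 (HAL pp. 26–28); Abhyankar1959, Thm. 1.47.) -/
theorem relLU_of_decompositionFieldLUAbove {O : ValuationSubring K} (h : DecompositionFieldLUAbove k O) :
    RelLocalUniformization k K O := by
  classical
  intro R hRfg hRfrac hRO
  obtain ⟨OE, hOE, η, hηO, ⟨x₀, hx₀⟩, ⟨f, hfO, hfη, hder⟩, K', hK'η, hLU⟩ := h
  haveI := hRfrac
  let L := AlgebraicClosure K
  let ι : K →+* L := algebraMap K L
  have hιinj : Function.Injective ι := (algebraMap K L).injective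
  let φ : K →ₐ[k] L := IsScalarTower.toAlgHom k K L
  have hφ : ∀ x : K, φ x = ι x := fun _ => rfl
  -- (1) membership in `O` and `v < 1` are read upstairs (`O = O_E ∩ K`)
  have hmemO : ∀ x : K, x ∈ O ↔ ι x ∈ OE := fun x => by
    rw [← hOE]; rfl
  have hvalO : ∀ y : K, O.valuation y < 1 ↔ OE.valuation (ι y) < 1 := fun y => by
    rw [← valuation_comap_lt_one_iff OE ι y, hOE]
  -- (2) the subfield `M = K` of `L = K̄`
  let M : Subfield L := ι.fieldRange
  have hMmem : ∀ y : L, y ∈ M ↔ ∃ x : K, ι x = y := fun y => RingHom.mem_fieldRange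
  have hιM : ∀ x : K, ι x ∈ M := fun x => (hMmem _).mpr ⟨x, rfl⟩
  have hkM : ∀ c : k, algebraMap k L c ∈ M := fun c => by
    rw [IsScalarTower.algebraMap_apply k K L]; exact hιM _
  -- `L | M` is normal (`L = K̄` is an algebraic closure of `M = K`)
  haveI : Algebra.IsAlgebraic M L := by
    refine ⟨fun y => ?_⟩
    obtain ⟨p, hp0, hpy⟩ := (Algebra.IsAlgebraic.isAlgebraic (R := K) y)
    let e : K ≃+* M := ι.rangeRestrictFieldEquiv
    refine ⟨p.map (e : K →+* M), fun h0 => hp0 ?_, ?_⟩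
    · exact (Polynomial.map_eq_zero_iff (e : K →+* M).injective).mp
        (by rw [h0])
    · rw [Polynomial.aeval_def, Polynomial.eval₂_map]
      have : (algebraMap M L).comp (e : K →+* M) = ι := by
        ext x; rfl
      rw [this]
      exact hpy
  haveI : IsAlgClosure M L := ⟨inferInstance, inferInstance⟩
  haveI : Normal M L := IsAlgClosure.normal M L
  -- (3) the Hensel root data read in `L`
  have hx₀' : ι x₀ ∈ M := hιM x₀
  have hfM : ∀ i, (f.map ι).coeff i ∈ M := fun i => by
    rw [Polynomial.coeff_map]; exact hιM _
  have hfO' : ∀ i, (f.map ι).coeff i ∈ OE := fun i => by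
    rw [Polynomial.coeff_map, ← hmemO]; exact hfO i
  have hfη' : (f.map ι).eval η = 0 := by
    rw [Polynomial.eval_map, ← Polynomial.aeval_def]; exact hfη
  have hder' : OE.valuation ((derivative (f.map ι)).eval η) = 1 := by
    rw [Polynomial.derivative_map, Polynomial.eval_map, ← Polynomial.aeval_def]; exact hder
  -- (4) the engine's Galois-approximation coefficients `c ⊆ K ∩ O`, pulled back to `K`
  obtain ⟨c, hcM, hcO, hreg⟩ :=
    exists_finset_regular_below OE k hkM hηO hx₀' hx₀ hfM hfO' hfη' hder'
  have hc_sub : (c : Set L) ⊆ Set.range ι := fun z hz => (hMmem z).mp (hcM hz)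
  let cK : Finset K := c.preimage ι hιinj.injOn
  have hιcK : ι '' (cK : Set K) = (c : Set L) := by
    rw [Finset.coe_preimage]; exact Set.image_preimage_eq_of_subset hc_sub
  -- (5) the enlarged model `R₂ = R[c] ⊆ O`
  obtain ⟨s₀, hs₀⟩ := hRfg
  let R₂ : Subalgebra k K := Algebra.adjoin k ((s₀ : Set K) ∪ (cK : Set K))
  have hRR₂ : R ≤ R₂ := by
    rw [← hs₀]; exact Algebra.adjoin_mono Set.subset_union_left
  have hR₂fg : R₂.FG := ⟨s₀ ∪ cK, by rw [Finset.coe_union]⟩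
  haveI : IsFractionRing R₂ K := isFractionRing_of_le hRR₂
  have hR₂O : R₂.toSubring ≤ O.toSubring := by
    change R₂ ≤ ({ O.toSubring with algebraMap_mem' := fun c => hRO (R.algebraMap_mem c) } : Subalgebra k K)
    refine Algebra.adjoin_le ?_
    rintro x (hx | hx)
    · rw [← hs₀] at hRO
      exact hRO (Algebra.subset_adjoin hx)
    · rw [Finset.mem_coe, Finset.mem_preimage] at hx
      exact (hmemO x).mpr (hcO _ hx)
  -- (6) the cell dominates `R₂` by a normal model `k[t₁]` with regular integral closure `k[t₁ ∪ t₁′]` in `K′`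
  obtain ⟨t₁, ht₁K, hR₂t₁, ht₁O, hnorm, t₁', ht₁'K', hext, hO', hreg'⟩ := hLU R₂ hR₂fg inferInstance hR₂O
  -- (7) hypotheses of the engine
  have hMK' : M ≤ K'.toSubfield := fun y hy => by
    obtain ⟨x, rfl⟩ := (hMmem y).mp hy
    exact K'.algebraMap_mem x
  have hK'cl : K'.toSubfield ≤ Subfield.closure ((M : Set L) ∪ {η}) := by
    intro y hy
    have hy' : y ∈ (K⟮η⟯).toSubfield := hK'η hy
    rw [IntermediateField.adjoin_toSubfield] at hy'
    have hM : Set.range (algebraMap K L) = (M : Set L) := (RingHom.coe_fieldRange ι).symm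
    rw [hM] at hy'
    exact hy'
  have ht₁M : (t₁ : Set L) ⊆ (M : Set L) := fun z hz => by
    obtain ⟨x, hx⟩ := ht₁K hz
    exact (hMmem z).mpr ⟨x, hx⟩
  have hadj_cl : (Algebra.adjoin k (t₁ : Set L) : Set L) ⊆
      (Subfield.closure (Set.range (algebraMap k L) ∪ (t₁ : Set L)) : Set L) := by
    intro z hz
    rw [SetLike.mem_coe, ← Subalgebra.mem_toSubring, Algebra.adjoin_eq_ring_closure] at hz
    exact Subring.closure_le.mpr (fun w hw => Subfield.subset_closure hw) hz
  have hMcl : M ≤ Subfield.closure (Set.range (algebraMap k L) ∪ (t₁ : Set L)) := by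
    intro y hy
    obtain ⟨x, rfl⟩ := (hMmem y).mp hy
    obtain ⟨a, b, -, hab⟩ := IsFractionRing.div_surjective (A := R₂) x
    rw [← hab, map_div₀]
    refine div_mem (hadj_cl (hR₂t₁ ?_)) (hadj_cl (hR₂t₁ ?_))
    · exact Subalgebra.mem_map.mpr ⟨a, a.2, rfl⟩
    · exact Subalgebra.mem_map.mpr ⟨b, b.2, rfl⟩
  have hnorm' : ∀ y : L, y ∈ M → IsIntegral (Algebra.adjoin k (t₁ : Set L)) y →
      y ∈ Algebra.adjoin k (t₁ : Set L) := by
    intro y hy hint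
    obtain ⟨x, rfl⟩ := (hMmem y).mp hy
    exact hnorm x hint
  have hct₁ : (c : Set L) ⊆ Algebra.adjoin k (t₁ : Set L) := by
    rw [← hιcK]
    rintro _ ⟨x, hx, rfl⟩
    refine hR₂t₁ (Subalgebra.mem_map.mpr ⟨x, ?_, rfl⟩)
    exact Algebra.subset_adjoin (Or.inr hx)
  have hext' : ∀ y : L, y ∈ K'.toSubfield → (IsIntegral (Algebra.adjoin k (t₁ : Set L)) y ↔
      y ∈ Algebra.adjoin k ((t₁ : Set L) ∪ (t₁' : Set L))) := fun y hy => hext y hy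
  -- (8) the engine: `k[t₁]` is regular at the centre of `O_E`
  have hregT := hreg K'.toSubfield hMK' hK'cl t₁ ht₁M hMcl ht₁O hnorm' hct₁ t₁' ht₁'K' hext' hO' hreg'
  -- (9) pull the model back to `K`
  let tK : Finset K := t₁.preimage ι hιinj.injOn
  have hιtK : ι '' (tK : Set K) = (t₁ : Set L) := by
    rw [Finset.coe_preimage]; exact Set.image_preimage_eq_of_subset ht₁K
  let A₀ : Subalgebra k K := Algebra.adjoin k (tK : Set K)
  have hA₀map : A₀.map φ = Algebra.adjoin k (t₁ : Set L) := by
    rw [AlgHom.map_adjoin, ← hιtK]; rfl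
  have hmemA₀ : ∀ x : K, x ∈ A₀ ↔ ι x ∈ Algebra.adjoin k (t₁ : Set L) := fun x => by
    rw [← hA₀map, Subalgebra.mem_map]
    constructor
    · exact fun hx => ⟨x, hx, rfl⟩
    · rintro ⟨y, hy, hyx⟩
      rwa [← hιinj hyx]
  have hRA₀ : R ≤ A₀ := fun x hx =>
    (hmemA₀ x).mpr (hR₂t₁ (Subalgebra.mem_map.mpr ⟨x, hRR₂ hx, rfl⟩))
  have hA₀fg : A₀.FG := ⟨tK, rfl⟩
  have hA₀O : A₀.toSubring ≤ O.toSubring := fun x hx => (hmemO x).mpr (ht₁O ((hmemA₀ x).mp hx))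
  refine ⟨A₀, hA₀O, hRA₀, hA₀fg, ?_⟩
  -- (10) transport of the local ring at the centre along `K ↪ K̄`
  have hT : A₀.toSubring.map ι = (Algebra.adjoin k (t₁ : Set L)).toSubring := by
    ext y
    rw [Subring.mem_map]
    constructor
    · rintro ⟨x, hx, rfl⟩
      exact (hmemA₀ x).mp hx
    · intro hy
      have hy' : y ∈ A₀.map φ := by rw [hA₀map]; exact hy
      obtain ⟨x, hx, rfl⟩ := Subalgebra.mem_map.mp hy'
      exact ⟨x, hx, rfl⟩
  let g : A₀.toSubring ≃+* (Algebra.adjoin k (t₁ : Set L)).toSubring :=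
    (A₀.toSubring.equivMapOfInjective ι hιinj).trans (RingEquiv.subringCongr hT)
  have hg : ∀ x : A₀.toSubring, ((g x : (Algebra.adjoin k (t₁ : Set L)).toSubring) : L) = ι x :=
    fun _ => rfl
  set P : Ideal A₀.toSubring := Ideal.comap (Subring.inclusion hA₀O) (IsLocalRing.maximalIdeal O) with hP
  set P' : Ideal (Algebra.adjoin k (t₁ : Set L)).toSubring :=
    Ideal.comap (Subring.inclusion ht₁O) (IsLocalRing.maximalIdeal OE) with hP'
  haveI : P'.IsPrime := Ideal.IsPrime.comap _
  haveI : P.IsPrime := Ideal.IsPrime.comap _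
  haveI hregP' : IsRegularLocalRing (Localization.AtPrime P') := hregT
  have hPP' : P = P'.comap g.toRingHom := by
    ext x
    simp only [hP, hP', Ideal.mem_comap, RingEquiv.toRingHom_eq_coe, RingHom.coe_coe]
    rw [ValuationSubring.valuation_lt_one_iff, ValuationSubring.valuation_lt_one_iff]
    change O.valuation (x : K) < 1 ↔ OE.valuation ((g x : (Algebra.adjoin k (t₁ : Set L)).toSubring) : L) < 1
    rw [hg]
    exact hvalO x
  have hmap : Submonoid.map g.toRingHom.toMonoidHom P.primeCompl = P'.primeCompl := by
    ext y
    constructor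
    · rintro ⟨x, hx, rfl⟩
      change g x ∉ P'
      have hx' : x ∉ P := hx
      rw [hPP', Ideal.mem_comap] at hx'
      exact hx'
    · intro hy
      have hy' : y ∉ P' := hy
      refine ⟨g.symm y, ?_, ?_⟩
      · change g.symm y ∉ P
        rw [hPP', Ideal.mem_comap]
        change ¬ g (g.symm y) ∈ P'
        rw [g.apply_symm_apply]
        exact hy'
      · change g (g.symm y) = y
        exact g.apply_symm_apply y
  exact IsRegularLocalRing.of_ringEquiv (R := Localization.AtPrime P')
    (IsLocalization.ringEquivOfRingEquiv (Localization.AtPrime P) (Localization.AtPrime P') g hmap).symm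

end Law

end Summit.ResolutionOfSingularities.ResolutionOfSingularities.Theorems.DecompositionDescentLU

end
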